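import Literature.NumberTheory.Automorphic.Liu2021.Def411WeilCarriersSurvivalNonsplit
import Literature.NumberTheory.Automorphic.HeckeCharacterLocalComponentSmooth
import HarnessLib

/-!
# Crux `HLiu418`, line LD2 — soft-road junction brick (E) `CentreDetCharExists`:
# the centre character `e′ = ∏_{w ∣ v} χ_w ∘ det` of a hermitian line `U(J′)(L⁺_v)` exists and has OPEN kernel

Cell hodgecm-mathlib (D-0151), FLOOR 0; crux item `HLiu418` = stmt-HodgeConjecture-24832; half-A line LD2 (leaf
`Cruxes/HLiu418/Lines/F0_P6LD_StubS1bFactsOrganRoad.lean`, organ stub `stub_organ_lineTypes₁`), soft-road junction skeleton of LD2-plan (g3)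
`F0/P6/LD/LD2-plan/g3/LTC1.softroad.junction.skeleton.v1.LD2-plang3.lean` (sha16 0547cc77bc6ebf26), brick **(E)** `CentreDetCharExists` (:60–:68),
dealt BY NAME to seat A-p13 (g40) (LD2-plan (g3) DEALS #13 (5), 2026-09-02T10:01:27Z).  THEOREMS ONLY (no `def`, no instance, no notation, no named
fact, no `sorry`); `--supports stmt-HodgeConjecture-24832`.

WHAT.  For a CM field `L` (complex conjugation `c̄`), a finite place `v` of `L⁺`, two hermitian lines `J₁, J′ ∈ M₁(L)` with `J′₀₀ ≠ 0` and a Hecke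
character `χ` of `L`: the map
`e′ : U(J′)(L⁺_v) → ℂˣ`, `z ↦ ∏_{w′ ∣ v} χ_{w′}(det ((z ↦ z·1) z)_{w′})`
(the local centre ★ `UnitaryGroup.localCenter … 1 J₁ J′ hJ′0 v : U(J′)(L⁺_v) →* U(J₁)(L⁺_v)` read in `Π_{w′ ∣ v} GL₁(L_{w′})`, then `det` and the local
components ★ `HeckeCharacter.localComponent`) IS a group homomorphism with OPEN kernel.  `centreDetCharExists` states this with the binders and the body of
the junction's `def CentreDetCharExists` TOKEN FOR TOKEN, so that `stub_centreDetCharExists := F0LD2CentreDetCharExists.centreDetCharExists` closes the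
stub by name once the junction is tree'd.

PROOF.  `e′` is the finite product (in the commutative group `U(J′)(L⁺_v) →* ℂˣ`) of the homomorphisms
`χ_{w′} ∘ det ∘ ev_{w′} ∘ subtype ∘ localCenter`; its kernel contains the finite intersection of the kernels of the factors, each the preimage of the
open kernel of `χ_{w′}` (★ `HeckeCharacter.isOpen_ker_localComponent`, [BushnellHenniart2006, §1.5]) under a continuous map (★ `continuous_localCenter`,
`continuous_subtype_val`, `continuous_apply`, `Matrix.GeneralLinearGroup.continuous_det`), hence is open (`Subgroup.isOpen_mono`).

HONEST LABEL.  Support-size bookkeeping; nothing of print is asserted.  HC_CM is proved only modulo the 7 printed citations (2 remaining: hLiu418 =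
stmt-HodgeConjecture-24832, h413 = stmt-HodgeConjecture-24833) until rung 0 closes; this file discharges none of them (a `--supports` helper of line LD2).

## References
* [Liu2021] Y. Liu, *Fourier–Jacobi cycles and arithmetic relative trace formula*, Camb. J. Math. 9 (2021) = arXiv:2102.11518, App. D Lemma D.1 (1)
  (the centre `E_v¹` of `U(V)(F_v)` acting through `μ_v ∘ det`).
* [GelbartRogawski1991] S. Gelbart, J. Rogawski, Invent. Math. 105 (1991), §3.2 p. 457.
* [BushnellHenniart2006] C. Bushnell, G. Henniart, *The local Langlands conjecture for GL(2)*, §1.5 (characters of locally profinite groups have open kernel).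
* [TateThesis1967] J. Tate, *Fourier analysis in number fields and Hecke's zeta-functions*, §4.3 (local components).
-/

set_option autoImplicit false
-- the mandated namespace has the single-problem summit's repeated segment (`HodgeConjecture.HodgeConjecture`)
set_option linter.dupNamespace false

noncomputable section

open scoped Matrix
open NumberField IsDedekindDomain
open Literature.NumberTheory Literature.NumberTheory.Automorphic Literature.NumberTheory.Automorphic.UnitaryGroup
open Literature.NumberTheory.GaloisRepresentations

namespace Summit.HodgeConjecture.HodgeConjecture.Cruxes.HLiu418.F0LD2CentreDetCharExists

/-! ## §1 The factors `χ_{w′} ∘ det ∘ ev_{w′} ∘ (z ↦ z·1)` -/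

section Factor

variable (L : Type) [Field L] [NumberField L] [IsCMField L] (v : HeightOneSpectrum (𝓞 (maximalRealSubfield L)))
  {J₁ J' : Matrix (Fin 1) (Fin 1) L} (hJ'0 : J' 0 0 ≠ 0) (χ : HeckeCharacter L)

/-- The `w′`-factor of the centre character: `z ↦ χ_{w′}(det ((z ↦ z·1) z)_{w′})`, a homomorphism `U(J′)(L⁺_v) →* ℂˣ`.
[cite: Liu2021, App. D Lemma D.1 (1)] [cite: TateThesis1967, §4.3] -/
theorem exists_factor (w' : PlacesOver L v) :
    ∃ f : localPi L (IsCMField.complexConj L) 1 J' v →* ℂˣ,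
      Continuous f ∧ IsOpen (f.ker : Set (localPi L (IsCMField.complexConj L) 1 J' v)) ∧
      ∀ z, f z = χ.localComponent w'.1 (Matrix.GeneralLinearGroup.det
        (((UnitaryGroup.localCenter L (IsCMField.complexConj L) 1 J₁ J' hJ'0 v z : localPi L (IsCMField.complexConj L) 1 J₁ v) :
          LocalGLPi L 1 v) w')) := by
  -- the continuous homomorphism `z ↦ det ((z ↦ z·1) z)_{w′} : U(J′)(L⁺_v) →* L_{w′}ˣ`
  let d : localPi L (IsCMField.complexConj L) 1 J' v →* (w'.1.adicCompletion L)ˣ :=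
    (Matrix.GeneralLinearGroup.det.comp (Pi.evalMonoidHom (fun w : PlacesOver L v => GL (Fin 1) (w.1.adicCompletion L)) w')).comp
      ((localPi L (IsCMField.complexConj L) 1 J₁ v).subtype.comp (UnitaryGroup.localCenter L (IsCMField.complexConj L) 1 J₁ J' hJ'0 v))
  have hd : Continuous d :=
    (Matrix.GeneralLinearGroup.continuous_det.comp (continuous_apply w')).comp
      (continuous_subtype_val.comp (UnitaryGroup.continuous_localCenter L (IsCMField.complexConj L) 1 J₁ J' hJ'0 v))
  refine ⟨(χ.localComponent w'.1).comp d, (χ.continuous_localComponent w'.1).comp hd, ?_, fun z => rfl⟩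
  -- the kernel is the preimage of the open kernel of `χ_{w′}`
  have hker : (((χ.localComponent w'.1).comp d).ker : Set (localPi L (IsCMField.complexConj L) 1 J' v)) =
      d ⁻¹' ((χ.localComponent w'.1).ker : Set (w'.1.adicCompletion L)ˣ) := by
    ext z
    simp only [SetLike.mem_coe, MonoidHom.mem_ker, MonoidHom.coe_comp, Function.comp_apply, Set.mem_preimage]
  rw [hker]
  exact (χ.isOpen_ker_localComponent w'.1).preimage hd

end Factor

/-! ## §2 The brick (E): the body of `F0LD2SoftRoadJunction.CentreDetCharExists`, token for token -/

/-- **(E) `CentreDetCharExists`** — the centre character `e′ = ∏_{w ∣ v} χ_w ∘ det` of the hermitian line `U(J′)(L⁺_v)` (read through `z ↦ z·1`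
into `U(J₁)(L⁺_v)`) exists as a homomorphism with OPEN kernel: the statement is the body of LD2-plan (g3)'s `def CentreDetCharExists` verbatim.
Proof: the finite product of the §1 factors; its kernel contains the (open) finite intersection of theirs.
[cite: Liu2021, App. D Lemma D.1 (1)] [cite: GelbartRogawski1991, §3.2 p. 457] [cite: BushnellHenniart2006, §1.5] -/
theorem centreDetCharExists :
    ∀ (L : Type) [Field L] [NumberField L] [IsCMField L] (v : HeightOneSpectrum (𝓞 (maximalRealSubfield L)))
    {J₁ J' : Matrix (Fin 1) (Fin 1) L} (hJ'0 : J' 0 0 ≠ 0) (χ : HeckeCharacter L),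
    ∃ e' : localPi L (IsCMField.complexConj L) 1 J' v →* ℂˣ,
      IsOpen (e'.ker : Set (localPi L (IsCMField.complexConj L) 1 J' v)) ∧
      ∀ z, e' z = ∏ w' : PlacesOver L v, χ.localComponent w'.1 (Matrix.GeneralLinearGroup.det
        (((UnitaryGroup.localCenter L (IsCMField.complexConj L) 1 J₁ J' hJ'0 v z : localPi L (IsCMField.complexConj L) 1 J₁ v) :
          LocalGLPi L 1 v) w')) := by
  intro L _ _ _ v J₁ J' hJ'0 χ
  choose f hfc hfo hf using exists_factor L v (J₁ := J₁) hJ'0 χ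
  refine ⟨∏ w' : PlacesOver L v, f w', ?_, fun z => ?_⟩
  · -- `ker (∏ f_{w′}) ⊇ ⨅ ker f_{w′}`, a finite intersection of open subgroups
    refine Subgroup.isOpen_mono (H₁ := ⨅ w' : PlacesOver L v, (f w').ker) ?_ ?_
    · intro z hz
      rw [MonoidHom.mem_ker, MonoidHom.finsetProd_apply]
      refine Finset.prod_eq_one fun w' _ => ?_
      exact (MonoidHom.mem_ker).1 (Subgroup.mem_iInf.1 hz w')
    · rw [Subgroup.coe_iInf]
      exact isOpen_iInter_of_finite fun w' => hfo w'
  · rw [MonoidHom.finsetProd_apply]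
    exact Finset.prod_congr rfl fun w' _ => hf w' z

end Summit.HodgeConjecture.HodgeConjecture.Cruxes.HLiu418.F0LD2CentreDetCharExists

end
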